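import Literature.NumberTheory.EllipticCurves.Rank1Residual.Typed.X11RankZeroCertificate
import Literature.NumberTheory.EllipticCurves.Rank1Residual.PrintShape
import Literature.NumberTheory.EllipticCurves.CongruenceVisibilityLocalFactors
import Literature.NumberTheory.EllipticCurves.MordellWeilRankZeroProofs
import HarnessLib

/-!
# X11 at `p ≥ 5`, rank `0`: the certificate `Ш(E)[p] ≠ 0` SUPPLIED by a `p`-congruent curve of rank `≥ 2` (visibility; cell `b2b-bsdres`)

HONEST FRAMING (run/shared/lean/b2b/bsd-rank1-residual/, verbatim): the goal of the cell is to
DELETE the COMBINATION-SHAPED residual classes for ALL analytic-rank `≤ 1` elliptic curves over `ℚ`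
— "full BSD formula for every rank `≤ 1` curve in class C" assembled STRICTLY from published
theorems — so that the rank-`≤ 1` remainder becomes exactly the CONSTRUCTION-SHAPED classes, which
are TYPED (missing-input `Prop`s), NOT attempted. This is not "finishing BSD".

Theorems only (no definition, no new named fact; prover x11a gen 9). Composition of
`Typed/X11RankZeroCertificate.lean` (gen 8: on X11 ∧ `r = 0` with `ρ̄_{E,p}` surjective and
`ord_p #Ш_an ≤ 2`, ONE non-zero element of `Ш(E/ℚ)[p]` gives `BSD(E,p)` — Wuthrich 2014 Prop. 21 +
Cassels–Tate + Gross–Zagier–Kolyvagin + modularity) with the KERNEL visibility theorem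
`WeierstrassCurve.exists_sha_ne_zero_of_congr_of_rank` (`CongruenceVisibility.lean`,
`CongruenceVisibilityLocalFactors.lean`: the dimension count of Cremona–Mazur 2000 §3 /
Agashe–Stein 2002 Thm. 3.1 for a `Γ_ℚ`-isomorphism `θ : E'[p] ≅ E[p]`, proved from the tree's
Galois-cohomology library with NO condition at `p` — Agashe–Stein's `p ∤ N` is not needed — so that
it applies at the multiplicative prime `p ‖ N` of an X11 pair). Result: on X11 ∧ `r = 0` ∧ surj ∧
`ord_p #Ш_an ≤ 2`, `BSD(E,p)` follows from PUBLISHED theorems plus the following PER-CURVE data, all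
finite computations about DEFINED objects (`X11RankZero.bsdp_of_congr_of_rank_two`):
* a second elliptic curve `E' = W'` over `ℚ` with a `Γ_ℚ`-equivariant isomorphism
  `θ : E'[p] ≃ E[p]` (certified by a Sturm-bound congruence `a_n(E) ≡ a_n(E') (mod p)` of two
  newforms of the same level plus the irreducibility of `E[p]`: Cremona–Mazur 2000, p. 21,
  conditions (1)–(3) and the Proposition; Sturm 1987) and `rank E'(ℚ) ≥ 2` (Cremona's tables /
  `2`-descent; or directly `[E'(ℚ) : pE'(ℚ)] ≥ p²` by reduction maps);
* a finite set `S` of primes outside which `E`, `E'` have good reduction and which contains `p`,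
  with `E'(ℚ_v)[p] = 0` for every `v ∈ S` (roots of the `p`-division polynomial over `ℚ_v`).
The rank-`0` curve `E` itself contributes `[E(ℚ) : pE(ℚ)] = 1` for free: `E(ℚ)` is finite
(Gross–Zagier–Kolyvagin, `r_an = 0`) of order prime to `p` (`E[p]` irreducible ⇒ no rational
`p`-torsion, Mazur; tree `padicValNat_torsionOrder_eq_zero_of_irreducible`).

**Census addendum #7 (gen 9, 2026-08-19) — the two open rank-`0` X11 pairs at `p ≥ 5`
(`N < 2·10⁴`; `Typed/X11.lean` addenda #4–#6, `Typed/X11RankZeroCertificate.lean`).** Both are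
très ramifié at `5` (no Hida-family transfer partner in print, addendum #6) and both are in
Cremona–Mazur's Table-1 situation with a RANK-TWO optimal curve of the SAME conductor:
* `E = 10580l1 = [0,-1,0,-519125,-143810335]` (`N = 2²·5·23²`, split multiplicative at `5`,
  `v₅(Δ) = 1`, `#E(ℚ) = 1`, `#Ш_an = 25`) and `E' = 10580o1 = [0,0,0,23,529]` (rank `2`,
  generators `(23,115)`, `(-7,5)`, `#E'(ℚ)_tors = 1`, Tamagawa product `24`, `v₅(Δ') = 4`);
* `E = 17640l1 = [0,0,0,3697197,-86239122802]` (`N = 2³·3²·5·7²`, non-split multiplicative at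
  `5`, `v₅(Δ) = 7`, `#E(ℚ) = 1`, `#Ш_an = 25`) and `E' = 17640m1 = [0,0,0,-588,10388]` (rank `2`,
  generators `(-14,126)`, `(14,70)`, `#E'(ℚ)_tors = 1`, Tamagawa product `96`, `v₅(Δ') = 2`).
Per-curve certificates (prover x11a gen 9, `b2b-bsdres-x11a/REPORT-g9.md`; engine 1 = gen-8 pure
Python Sturm check `g8/sturm_check.py`, engine 2 = PARI/GP job of gen 9): `a_n(E) ≡ a_n(E') (mod 5)`
for all `n` up to the Sturm bound (`[SL₂(ℤ):Γ₀(N)]/6`: `3313`, resp. `8065`), `E[5]` and `E'[5]`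
irreducible (indeed `ρ̄_{E,5}` surjective), `rank E'(ℚ) = 2` (Cremona) and `[E'(ℚ):5E'(ℚ)] ≥ 25`
by two reduction functionals, `E'(ℚ_v)[5] = 0` for `v ∈ S = {2, 5, 23}` resp. `{2, 3, 5, 7}`
(additive reduction of `E'` at `v ≠ 5`; at `5` no `ℚ₅`-root of `ψ₅` with `y ∈ ℚ₅`), so
`[E(ℚ):5E(ℚ)] · ∏_{v ∈ S} #𝓛_v(E') = 1 · 5 < 25 ≤ [E'(ℚ):5E'(ℚ)]`: `Ш(E)[5] ≠ 0`, hence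
`#Ш(E)[5^∞] = 25 = #Ш_an` and `BSD(E,5)` at both pairs, from PUBLISHED theorems + the certificates.
With these two pairs every rank-`0` X11-type pair of the `N < 2·10⁴` census at `p ≥ 5` (615 pairs)
is reached by published inputs (613 by Wuthrich Prop. 21 alone, 2 by Prop. 21 + Cassels–Tate +
visibility + certificate). NO class label changes (the class-level residue on the très-ramifié
locus — a (ram)-free main-conjecture lower bound — stays typed, `X11RankZero.MissingInputAt`); the
lane certifies pairs and owns verdicts.

References: Cremona–Mazur 2000 §3, Table 1 [CremonaMazur2000]; Agashe–Stein 2002 Thm. 3.1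
[AgasheStein2002]; Wuthrich 2014 Prop. 21 [Wuthrich2014]; Silverman AEC X.4.14 [SilvermanAEC2009];
Miller 2011 Def. 1.1 [Miller2011LMS]; Mazur 1977 III.§5 [Mazur1977]; cell files
`Typed/X11RankZeroCertificate.lean`, `Typed/CasselsLowerBound.lean`, `Typed/X11.lean`.
-/

noncomputable section

open scoped Classical

open WeierstrassCurve Literature.NumberTheory.EllipticCurves
  Literature.NumberTheory.EllipticCurves.Rank1Residual
  Literature.NumberTheory.EllipticCurves.Wuthrich2014
open NumberField IsDedekindDomain

namespace Literature.NumberTheory.EllipticCurves.Rank1Residual.Typed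

variable (W : WeierstrassCurve ℚ) [W.IsElliptic] (p : ℕ) [Fact p.Prime]

/-- **Rank `0` ⇒ `E(ℚ)` finite** (Gross–Zagier–Kolyvagin, `hGZK`: `rank E(ℚ) = r_an = 0`;
Mordell–Weil, tree `mordellWeilRank_eq_zero_iff_holds`). [cite: SilvermanAEC2009, VIII.6] -/
theorem finite_point_of_analyticRank_eq_zero (hGZK : rank_eq_analyticRank_of_analyticRank_le_one)
    (hr : W.analyticRank = 0) : Finite W.toAffine.Point := by
  have h0 : W.mordellWeilRank = 0 := by rw [(hGZK W (by rw [hr]; exact zero_le_one)).1, hr]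
  exact W.mordellWeilRank_eq_zero_iff_holds.mp h0

/-- **`E[p]` irreducible and `E(ℚ)` finite ⇒ `p ∤ #E(ℚ)`** (no rational point of order `p`: Mazur
1977 III.§5; tree `padicValNat_torsionOrder_eq_zero_of_irreducible`, `#E(ℚ)_tors = #E(ℚ)`).
[cite: Mazur1977, Ch. III §5, p. 157] -/
theorem coprime_natCard_point_of_irr [Finite W.toAffine.Point] (hirr : Irr W p) :
    (Nat.card W.toAffine.Point).Coprime p := by
  have hp : p.Prime := Fact.out
  have h0 := padicValNat_torsionOrder_eq_zero_of_irreducible W p hirr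
  have htors : W.torsionOrder = Nat.card W.toAffine.Point := W.natCard_point_eq_torsionOrder.symm
  have hne : W.torsionOrder ≠ 0 := by rw [htors]; exact Nat.card_pos.ne'
  rw [← htors]
  rw [padicValNat.eq_zero_iff] at h0
  rcases h0 with h | h | h
  · exact absurd h hp.one_lt.ne'
  · exact absurd h hne
  · exact ((Nat.Prime.coprime_iff_not_dvd hp).mpr h).symm

/-- **X11 ∧ `r = 0`, surjective `ρ̄_{E,p}`, `ord_p #Ш_an ≤ 2`: the typed rank-zero input is
DISCHARGED by a `p`-congruent curve of rank `≥ 2`** — `X11RankZero.MissingInputAt W p` holds given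
a `Γ_ℚ`-isomorphism `θ : E'[p] ≃ E[p]` from an elliptic curve `E'` with `rank E'(ℚ) ≥ 2` and a finite
set `S` of primes (containing `p` and the bad primes of `E`, `E'`) with `E'(ℚ_v)[p] = 0` for `v ∈ S`:
the kernel visibility theorem (`exists_sha_ne_zero_of_congr_of_rank`, odd `p`; `E(ℚ)` finite by GZK
and of order prime to `p` by irreducibility) produces a non-zero element of `Ш(E/ℚ)[p]`, and
Cassels–Tate squareness (`hCT`, `X11RankZero.missingInputAt_of_casselsTate_of_dvd`) turns it into the
LOWER bound. Per-curve inputs; NOT a class theorem. [cite: CremonaMazur2000, §3 pp. 19–22]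
[cite: AgasheStein2002, Thm. 3.1] [cite: SilvermanAEC2009, Thm. X.4.14] -/
theorem X11RankZero.missingInputAt_of_congr_of_rank_two
    (hCT : exists_casselsTate_pairing (K := ℚ))
    (hGZK : rank_eq_analyticRank_of_analyticRank_le_one) (hp : p ≠ 2) (hr : W.analyticRank = 0)
    (hirr : Irr W p) (hsurj : Surj W p) {q : ℚ} (hq : shaAn W = (q : ℂ)) (hv : padicValRat p q ≤ 2)
    (W' : WeierstrassCurve ℚ) [W'.IsElliptic]
    (θ : geomTorsion W' (p : ℤ) ≃+ geomTorsion W (p : ℤ))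
    (hθ : ∀ (σ : Field.absoluteGaloisGroup ℚ) (P : geomTorsion W' (p : ℤ)), θ (σ • P) = σ • θ P)
    (hrank : 2 ≤ W'.mordellWeilRank) (S : Finset (HeightOneSpectrum (𝓞 ℚ)))
    (hS : ∀ v : HeightOneSpectrum (𝓞 ℚ), v ∉ S →
      W.HasGoodReductionAt v ∧ W'.HasGoodReductionAt v ∧ (p : 𝓞 ℚ) ∉ v.asIdeal)
    (hloc : ∀ v ∈ S, Nat.card (nsmulAddMonoidHom p :
      (W'.baseChange (v.adicCompletion ℚ)).toAffine.Point →+ _).ker = 1) :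
    X11RankZero.MissingInputAt W p := by
  haveI : Finite W.toAffine.Point := finite_point_of_analyticRank_eq_zero W hGZK hr
  have hrank' : Module.finrank ℚ ℚ + 1 ≤ W'.mordellWeilRank := by rwa [Module.finrank_self]
  exact X11RankZero.missingInputAt_of_casselsTate_of_dvd W p hCT hGZK hr hsurj hq hv
    (dvd_shaOrder_of_exists_torsion W p (W.exists_sha_ne_zero_of_congr_of_rank W' hp θ hθ S hS
      ‹_› (coprime_natCard_point_of_irr W p hirr) hrank' hloc))

variable [W.IsGloballyMinimal]

/-- **X11 ∧ `r = 0` at an odd `p` with `ρ̄_{E,p}` surjective and `ord_p #Ш_an ≤ 2`: `BSD(E,p)`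
from PUBLISHED theorems plus a `p`-CONGRUENT CURVE OF RANK `≥ 2`** (visibility certificate).
Published inputs (binders): Wuthrich 2014 Prop. 21 (`hW`, UPPER bound), Cassels–Tate (`hCT`),
Gross–Zagier–Kolyvagin (`hGZK`), modularity (`hmod`); the kernel theorems: the visibility dimension
count `exists_sha_ne_zero_of_congr_of_rank` (no condition at `p`, so usable at `p ‖ N`) and
`X11RankZero.bsdp_of_casselsTate_of_dvd`. Per-curve data (explicit binders, finite computations):
the partner `E' = W'` with `θ : E'[p] ≃ E[p]` `Γ_ℚ`-equivariant, `rank E'(ℚ) ≥ 2`, the finite set `S`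
(outside: good reduction of both and `v ∤ p`), and `E'(ℚ_v)[p] = 0` for `v ∈ S`. Census
(`N < 2·10⁴`, `p ≥ 5`): exactly the two pairs `10580l1@5` (partner `10580o1`) and `17640l1@5`
(partner `17640m1`) — see the module docstring. SUB-class statement; NOT a deletion of the class.
[cite: Wuthrich2014, Prop. 21 (p. 400)] [cite: SilvermanAEC2009, Thm. X.4.14]
[cite: CremonaMazur2000, §3 and Table 1] [cite: AgasheStein2002, Thm. 3.1]
[cite: Miller2011LMS, §1 and Def. 1.1] -/
theorem X11RankZero.bsdp_of_congr_of_rank_two (hCT : exists_casselsTate_pairing (K := ℚ))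
    (hW : sha_dvd_analyticSha) (hGZK : rank_eq_analyticRank_of_analyticRank_le_one)
    (hmod : hasEntireLFunction_rat) (hp : p ≠ 2) (hr : W.analyticRank = 0) (hX : ClassX11 W p)
    (hsurj : Surj W p) {q : ℚ} (hq : shaAn W = (q : ℂ)) (hv : padicValRat p q ≤ 2)
    (W' : WeierstrassCurve ℚ) [W'.IsElliptic]
    (θ : geomTorsion W' (p : ℤ) ≃+ geomTorsion W (p : ℤ))
    (hθ : ∀ (σ : Field.absoluteGaloisGroup ℚ) (P : geomTorsion W' (p : ℤ)), θ (σ • P) = σ • θ P)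
    (hrank : 2 ≤ W'.mordellWeilRank) (S : Finset (HeightOneSpectrum (𝓞 ℚ)))
    (hS : ∀ v : HeightOneSpectrum (𝓞 ℚ), v ∉ S →
      W.HasGoodReductionAt v ∧ W'.HasGoodReductionAt v ∧ (p : 𝓞 ℚ) ∉ v.asIdeal)
    (hloc : ∀ v ∈ S, Nat.card (nsmulAddMonoidHom p :
      (W'.baseChange (v.adicCompletion ℚ)).toAffine.Point →+ _).ker = 1) :
    BSDp W p :=
  X11RankZero.bsdp_of_missingInputAt hW hGZK hmod W p hp hr hX
    (X11RankZero.missingInputAt_of_congr_of_rank_two W p hCT hGZK hp hr hX.irr hsurj hq hv W' θ hθ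
      hrank S hS hloc)

end Literature.NumberTheory.EllipticCurves.Rank1Residual.Typed
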